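import Mathlib
import HarnessLib

/-!
# `FixedLower` — parity bit at shifted primes: definitions (helper vocabulary for stmt-Parity-26863)

Decomp-parity lens-4 g8 consequence notch «ParityBitFloor» beneath the record leaf
`FL = SiegelSpectrumSplit.FixedLower` (stmt-Parity-26863; critic CLEARED HOME/STATUS.md l.509, CRITIC-LEDGER
row 92; writer ruling l.508: hand only, Defs first).  Three DATA definitions of type `Set ℕ` — the sets of the
PRIME-BUDGET axis on the twin face (`j` = number of coordinates of `(n, n+2)` required to be prime, the others
only parity-correct, i.e. `λ = -1`):

* `oddShiftSet`  (`j = 1`): primes `p` with `Ω(p+2)` odd, i.e. `λ(p+2) = -1 = λ(p)`; its infinitude is the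
  notch's credited piece «OddShift» (open in print: Pintz, Indag. Math. 26 (2015), p. 2);
* `evenShiftSet`: primes `p` with `Ω(p+2)` even (the complementary parity class);
* `sameSignSet`  (`j = 0`): `n ≥ 1` with `λ(n) = λ(n+2)` (proved infinite in `FixedLowerParityBit.lean`).

`j = 2` is the barrier file's `Literature.Barriers.Parity.twinSet`.  The theorems (necessity from `FL`, exactness,
the parity bit, the barrier floor, `sameSignSet` infinite) are in `Theorems/FixedLowerParityBit.lean`.
No `def : Prop`; definitions only.
-/

open ArithmeticFunction

namespace Summit.Parity.GeneralizedHardyLittlewood.ParityBit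

/-! ## §1 The three sets of the prime-budget axis -/

/-- Budget `j = 1`: primes `p` with `Ω(p+2)` odd (equivalently `λ(p+2) = -1 = λ(p)`). -/
def oddShiftSet : Set ℕ := {p | p.Prime ∧ Odd (cardFactors (p + 2))}

/-- The complementary class: primes `p` with `Ω(p+2)` even (`λ(p+2) = +1`). -/
def evenShiftSet : Set ℕ := {p | p.Prime ∧ Even (cardFactors (p + 2))}

/-- Budget `j = 0`: `λ(n) = λ(n+2)`, `n ≥ 1`. -/
def sameSignSet : Set ℕ := {n | 0 < n ∧ liouville n = liouville (n + 2)}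

end Summit.Parity.GeneralizedHardyLittlewood.ParityBit
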